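import Summits.CriticalPhenomena.PercolationContinuityZ3.Theorems.PercNearOneGluingNoHeavyQuantMissedRelays
import HarnessLib

/-!
# Quantitative additive gluing, VII: the pure counting bound `(|A| − j)·μ(1 ≤ N ≤ j) ≤ |A|·μ(o ↔ A) − EN` and LNT♯-EN in the regime
# `s ≥ (|A| − 2j)/(|A| − j)`

Support file (`--supports stmt-CriticalPhenomena-4575`), seat `prim-quant-p1` (lane QUANT, LNT♯-EN task); builds on p205010 (kernel theorem,
internal audit signed; external expert review pending).  No definitions, no named facts, no sorries; standard axioms.

With `N = #{a ∈ A : o ↔ a}`, `U = {o ↔ A}`, `EN = Σ_a μ(o ↔ a) = E[N]`: the missed count `|A| − N` is `≥ |A| − j` on `{1 ≤ N ≤ j}` and has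
`E[|A| − N; U] = |A|·μ(U) − EN` exactly; so `(|A| − j)·μ(1 ≤ N ≤ j) ≤ |A|·μ(U) − EN` with NO correlation input (`lowCount_counting`).  Consequently
the conjectured sharp linear lower tail LNT♯-EN `μ(1 ≤ N < EN/2) ≤ s·μ(U)` holds automatically when the pairwise slack `s` is LARGE:
`lntEN_of_large_s` — if `2j < EN ≤ 2(j+1)` and `(|A| − 2j) ≤ s·(|A| − j)` then `μ(1 ≤ N ∧ N < EN/2) ≤ s·μ(U)`.
Together with `lntEN_card_le_four` / `singleRelay_le` (`…QuantMissedRelays.lean`: the layer `j = 1`, constant one) and `lntEN_of_clusterSmall`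
(`…QuantClusterSmallBound.lean`: reduction to the observer-free conjecture L(j)), the open part of LNT♯-EN is exactly: `j* = ⌈EN/2⌉ − 1 ≥ 2` and
`s < (|A| − 2j*)/(|A| − j*)` (many relays, few caught on average, all pairs reliable) — where the seat census finds only equalities (glued families).
[cite: KozmaNitzan2024, Conjecture 3 (p. 15)]
-/

noncomputable section

namespace Summit.CriticalPhenomena.PercolationContinuityZ3.Theorems

open MeasureTheory Set
open Literature.Probability.LatticeModels (prodBernoulli)
open Literature.Probability.Percolation
open scoped Classical

namespace QuantGluing

variable {n : ℕ}

/-- **Pure counting**: `(|A| − j)·μ(1 ≤ N ∧ N ≤ j) ≤ |A|·μ(o ↔ A) − Σ_a μ(o ↔ a)` (first moment of the missed count on the event; no correlation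
inequality). [folklore] -/
theorem lowCount_counting (n : ℕ) (w : Sym2 (Fin n) → unitInterval) (A : Finset (Fin n)) (o : Fin n) (j : ℕ) :
    ((A.card : ℝ) - j) * (prodBernoulli w).real {ω : BondConfig (Fin n) | 1 ≤ (A.filter fun a => ω ∈ openConn o a).card ∧
        (A.filter fun a => ω ∈ openConn o a).card ≤ j} ≤
      (A.card : ℝ) * (prodBernoulli w).real (⋃ a ∈ A, openConn o a) - ∑ a ∈ A, (prodBernoulli w).real (openConn o a) := by
  set μ := prodBernoulli w with hμ
  have hmeas : ∀ S : Set (BondConfig (Fin n)), MeasurableSet S := fun S => (Set.toFinite S).measurableSet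
  set E : Set (BondConfig (Fin n)) := {ω | 1 ≤ (A.filter fun a => ω ∈ openConn o a).card ∧
      (A.filter fun a => ω ∈ openConn o a).card ≤ j} with hE
  set U : Set (BondConfig (Fin n)) := ⋃ a ∈ A, openConn o a with hU
  have hEU : E ⊆ U := by
    intro ω hω
    obtain ⟨h1, -⟩ := hω
    obtain ⟨a, ha⟩ := Finset.card_pos.1 h1
    rw [Finset.mem_filter] at ha
    exact Set.mem_biUnion (Finset.mem_coe.2 ha.1) ha.2
  have hcount : ((A.card : ℝ) - j) * μ.real E ≤ ∑ a' ∈ A, μ.real (E ∩ (openConn o a' : Set (BondConfig (Fin n)))ᶜ) := by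
    refine halfLeSevenForms_mul_measureReal_le_sum_inter μ A
      (fun a' => (openConn o a' : Set (BondConfig (Fin n)))ᶜ) (fun a _ => hmeas _) (hmeas E) ((A.card : ℝ) - j)
      fun ω hω => ?_
    rw [← halfLeSevenForms_card_filter_eq_sum_indicator]
    have hsplit := Finset.card_filter_add_card_filter_not (s := A) (fun a => ω ∈ openConn o a)
    obtain ⟨-, h2⟩ := hω
    have hcast : ((A.filter fun a => ω ∈ openConn o a).card : ℝ) +
        ((A.filter fun a => ¬ ω ∈ openConn o a).card : ℝ) = A.card := by exact_mod_cast hsplit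
    have h2' : ((A.filter fun a => ω ∈ openConn o a).card : ℝ) ≤ j := by exact_mod_cast h2
    have hrw : ((A.filter fun a => ω ∈ (openConn o a : Set (BondConfig (Fin n)))ᶜ).card : ℝ) =
        ((A.filter fun a => ¬ ω ∈ openConn o a).card : ℝ) := rfl
    rw [hrw]
    linarith
  have hmono : ∑ a' ∈ A, μ.real (E ∩ (openConn o a' : Set (BondConfig (Fin n)))ᶜ) ≤
      ∑ a' ∈ A, μ.real (U ∩ (openConn o a' : Set (BondConfig (Fin n)))ᶜ) :=
    Finset.sum_le_sum fun a' _ => measureReal_mono (Set.inter_subset_inter_left _ hEU) (measure_ne_top _ _)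
  have hsplit : ∀ a' ∈ A, μ.real (U ∩ (openConn o a' : Set (BondConfig (Fin n)))ᶜ) = μ.real U - μ.real (openConn o a') := by
    intro a' ha'
    have h := measureReal_inter_add_sdiff (μ := μ) (s := U) (hmeas (openConn o a')) (measure_ne_top _ _)
    rw [Set.sdiff_eq, Set.inter_eq_right.2 (Set.subset_iUnion₂ (s := fun x (_ : x ∈ A) => (openConn o x : Set (BondConfig (Fin n)))) a' ha')] at h
    linarith
  have htot : ∑ a' ∈ A, μ.real (U ∩ (openConn o a' : Set (BondConfig (Fin n)))ᶜ) =
      A.card * μ.real U - ∑ a' ∈ A, μ.real (openConn o a') := by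
    rw [Finset.sum_congr rfl hsplit, Finset.sum_sub_distrib, Finset.sum_const]; simp
  linarith [hcount, hmono, htot]

/-- **LNT♯-EN in the large-slack regime**: if `2j < EN ≤ 2(j+1)` (i.e. `j = ⌈EN/2⌉ − 1`) and `(|A| − 2j) ≤ s·(|A| − j)`, then
`μ(1 ≤ N ∧ N < EN/2) ≤ s·μ(o ↔ A)` — by counting alone: `(|A| − j)·μ(E) ≤ |A|·μ(U) − EN < |A|·μ(U) − 2j ≤ (|A| − 2j)·μ(U) ≤ s·(|A| − j)·μ(U)`.
[cite: KozmaNitzan2024, Conjecture 3 (p. 15)] -/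
theorem lntEN_of_large_s (n : ℕ) (w : Sym2 (Fin n) → unitInterval) (A : Finset (Fin n)) (o : Fin n) (j : ℕ) (s : ℝ)
    (hj : 2 * (j : ℝ) < ∑ a ∈ A, (prodBernoulli w).real (openConn o a))
    (hj' : (∑ a ∈ A, (prodBernoulli w).real (openConn o a)) ≤ 2 * (j + 1))
    (hs : ((A.card : ℝ) - 2 * j) ≤ s * ((A.card : ℝ) - j)) :
    (prodBernoulli w).real {ω : BondConfig (Fin n) | 1 ≤ (A.filter fun a => ω ∈ openConn o a).card ∧
        ((A.filter fun a => ω ∈ openConn o a).card : ℝ) < (∑ a ∈ A, (prodBernoulli w).real (openConn o a)) / 2} ≤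
      s * (prodBernoulli w).real (⋃ a ∈ A, openConn o a) := by
  set μ := prodBernoulli w with hμ
  set EN : ℝ := ∑ a ∈ A, μ.real (openConn o a) with hEN
  have hcnt := lowCount_counting n w A o j
  rw [← hμ] at hcnt
  have hsub : {ω : BondConfig (Fin n) | 1 ≤ (A.filter fun a => ω ∈ openConn o a).card ∧
        ((A.filter fun a => ω ∈ openConn o a).card : ℝ) < EN / 2} ⊆
      {ω : BondConfig (Fin n) | 1 ≤ (A.filter fun a => ω ∈ openConn o a).card ∧ (A.filter fun a => ω ∈ openConn o a).card ≤ j} := by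
    intro ω hω
    obtain ⟨h1, h2⟩ := hω
    refine ⟨h1, ?_⟩
    have h3 : ((A.filter fun a => ω ∈ openConn o a).card : ℝ) < j + 1 := by linarith
    have h4 : (A.filter fun a => ω ∈ openConn o a).card < j + 1 := by exact_mod_cast h3
    omega
  have hmono := measureReal_mono (μ := μ) hsub (measure_ne_top _ _)
  -- `EN ≤ |A|·max ≤ …`: we need `μ(U) ≤ 1` and `|A| > j` for the division; if `|A| ≤ j` the event is empty-ish: handle via the sign of `|A| − j`
  have hU1 : μ.real (⋃ a ∈ A, openConn o a : Set (BondConfig (Fin n))) ≤ 1 := measureReal_le_one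
  have hU0 : 0 ≤ μ.real (⋃ a ∈ A, openConn o a : Set (BondConfig (Fin n))) := measureReal_nonneg
  have hENU : EN ≤ (A.card : ℝ) * μ.real (⋃ a ∈ A, openConn o a : Set (BondConfig (Fin n))) := by
    -- each `μ(o ↔ a) ≤ μ(U)`
    have : ∀ a ∈ A, μ.real (openConn o a : Set (BondConfig (Fin n))) ≤ μ.real (⋃ a ∈ A, openConn o a : Set (BondConfig (Fin n))) :=
      fun a ha => measureReal_mono (Set.subset_iUnion₂ (s := fun x (_ : x ∈ A) => (openConn o x : Set (BondConfig (Fin n)))) a ha)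
        (measure_ne_top _ _)
    calc EN = ∑ a ∈ A, μ.real (openConn o a : Set (BondConfig (Fin n))) := rfl
      _ ≤ ∑ a ∈ A, μ.real (⋃ a ∈ A, openConn o a : Set (BondConfig (Fin n))) := Finset.sum_le_sum this
      _ = (A.card : ℝ) * μ.real (⋃ a ∈ A, openConn o a : Set (BondConfig (Fin n))) := by rw [Finset.sum_const]; simp
  rcases le_or_gt ((A.card : ℝ) - j) 0 with hneg | hpos
  · -- `|A| ≤ j`: then `EN ≤ |A| μ(U) ≤ |A| ≤ j < … ` contradicts `2j < EN` unless trivial; in fact `2j < EN ≤ |A| ≤ j` forces `j = 0`, `|A| = 0`, `EN > 0`: impossible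
    exfalso
    have hA : (A.card : ℝ) ≤ j := by linarith
    have hj0 : (0 : ℝ) ≤ j := by positivity
    nlinarith [hENU, hU1, hj, hA, hj0, hU0]
  · have key : ((A.card : ℝ) - j) * μ.real {ω : BondConfig (Fin n) | 1 ≤ (A.filter fun a => ω ∈ openConn o a).card ∧
        ((A.filter fun a => ω ∈ openConn o a).card : ℝ) < EN / 2} ≤
        ((A.card : ℝ) - j) * (s * μ.real (⋃ a ∈ A, openConn o a : Set (BondConfig (Fin n)))) := by
      have h1 : ((A.card : ℝ) - j) * μ.real {ω : BondConfig (Fin n) | 1 ≤ (A.filter fun a => ω ∈ openConn o a).card ∧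
          ((A.filter fun a => ω ∈ openConn o a).card : ℝ) < EN / 2} ≤ (A.card : ℝ) * μ.real (⋃ a ∈ A, openConn o a) - EN :=
        (mul_le_mul_of_nonneg_left hmono hpos.le).trans hcnt
      -- `|A| μ(U) − EN < |A| μ(U) − 2j ≤ (|A| − 2j) μ(U)` uses `2j(1 − μ(U)) ≥ 0`
      have hj0 : (0 : ℝ) ≤ j := by positivity
      have h2 : (A.card : ℝ) * μ.real (⋃ a ∈ A, openConn o a : Set (BondConfig (Fin n))) - EN ≤
          ((A.card : ℝ) - 2 * j) * μ.real (⋃ a ∈ A, openConn o a : Set (BondConfig (Fin n))) := by nlinarith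
      have h3 : ((A.card : ℝ) - 2 * j) * μ.real (⋃ a ∈ A, openConn o a : Set (BondConfig (Fin n))) ≤
          s * ((A.card : ℝ) - j) * μ.real (⋃ a ∈ A, openConn o a : Set (BondConfig (Fin n))) :=
        mul_le_mul_of_nonneg_right hs hU0
      nlinarith
    exact le_of_mul_le_mul_left key hpos

end QuantGluing

end Summit.CriticalPhenomena.PercolationContinuityZ3.Theorems

end
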